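import Literature.NumberTheory.GaloisCohomology.Howard2004.TowerSelmerTransposeDualSelmerProofs
import Literature.NumberTheory.GaloisCohomology.Howard2004.DualityDatumSelmerTransferProofs
import Literature.NumberTheory.GaloisCohomology.Howard2004.SelfOrthogonalBaseChangeProofs
import HarnessLib

/-!
# Howard 2004, Prop. 1.4.1 / Thm. 1.4.2 (ii) — the H.4 readings `Θ_j : Tw(T^{(j)}) → T^{(j)*}` of two levels are
# COMPATIBLE along `ι : T^{(0)} ↪ T^{(t+1)}` and `red : T^{(t+1)} ↠ T^{(0)}`; the cross-level adjunctions
# ADJ-ι-T / ADJ-red-T of the local Tate pairings against `Θ_j ∘ transport` — proofs file (brick «C451-CL READ-COMPAT»)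

Topic `NumberTheory/GaloisCohomology/Howard2004`. THEOREMS ONLY: no definition, no named fact, no instance, no notation,
no `sorry`.  Cell `pub/bsd-print-x9` (seat x10b-p1-w8 g12, brick «READ-COMPAT» of LEAD g14's class-level port plan = the
cross-level letters the skew step Q6 and the assembly Q7 consume; `--supports stmt-BirchSwinnertonDyer-22642`; print leaf
G87 ↦ the «Flach leaf» C45.1′ / C45.1″).  Sequel of `TowerSelmerTransposeDualSelmerProofs` (generic transpose adjunction).

SOURCE. B. Howard, *The Heegner point Kolyvagin system*, Compositio Math. **140** (2004) = arXiv:1202.6340: H.4 «the pairings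
are compatible under reduction» (p. 7 L69–82; tree `SatisfiesH.e_red`), §1.6 `T^{(k)} = T/𝔪^{e_k}` with `ι_s ∘ red = π^s`
(p. 11 L13–38), proof of Thm. 1.4.2 (ii) (p0008 L142 – p0009 L55: every term is moved to the bottom level); J. Neukirch,
A. Schmidt, K. Wingberg, *Cohomology of Number Fields*, I §4 (1.4.2); J. Milne, *Arithmetic Duality Theorems*, Ch. I §2.

SETTING.  A `DVRSetting` `S` with H.0–H.5 (`hy`); the levels `0` and `t+1`; an `R`-linear equivariant `ι : T^{(0)} → T^{(t+1)}`
with `ι ∘ red = π^d`, `d = e_{t+1} - e_0` (tree `exists_linearMap_comp_redLE_eq`); ONE exponent `p^{k′}` for both levels;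
additive characters `λ₀ : R_0 → ℤ/p^{k′}`, `λ₁ : R_{t+1} → ℤ/p^{k′}` (with the `ℤ_p`-semilinearity `hlam` of the reading
files) which are **COMPATIBLE**: `λ₁(π^d r) = λ₀(r mod 𝔪^{e_0})` (`hcompat`, stated through `R`); an equivariant
trivialisation `exp : ℤ/p^{k′} → μ_{p^{k′}}`; `Θ_j := (S.D j).toTateDual λ_j hλ_j exp hexp` (`Θ_j t s = exp λ_j e_j(s, t)`).

WHAT IS PROVED.
* §1 `e_smul_left` / `e_smul_right` (the `R`-action passes through `algebraMap R R_j`), **`e_redLE_of_eq_algebraMap`** — `e_red`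
  ITERATED: `e_j(x, y) = [r] ⟹ e_i(red x, red y) = [r]` for `i ≤ j`.
* §2 THE MODULE IDENTITIES: **`transpose_iota_toTateDual_eq`** `ι^D ∘ Θ_{t+1} = Θ₀ ∘ red` on `Tw T^{(t+1)}`, and
  **`toTateDual_iota_eq_transpose_red`** `Θ_{t+1} ∘ ι = red^D ∘ Θ₀` on `Tw T^{(0)}` (`φ^D = pairingDualHom (ev ∘ φ)` the transpose
  of `TowerSelmerTransposeDualSelmerProofs`; both from `ι ∘ red = π^d`, bilinearity, `e_red` iterated and `hcompat`).
* §3 THE CROSS-LEVEL ADJUNCTIONS at a finite place `v` (`T^j_v := H¹(Θ_j) ∘ transport_v : H¹(K_{σv}, T^{(j)}) → H¹(K_v, T^{(j)*})`,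
  `H¹(Θ_j)` in the bridge's currency `galoisCohomology.map (localMap Θ_j v) 1`):
  **ADJ-ι-T `localTatePairing_cohomologyMap_iota_thetaTransport`** `⟨ι_* m, T^{t+1}_v z⟩_{t+1} = ⟨m, T⁰_v (red_* z)⟩_0`
  (`m ∈ H¹(K_v, T^{(0)})`, `z ∈ H¹(K_{σv}, T^{(t+1)})`);
  **ADJ-red-T `localTatePairing_thetaTransport_iota`** `⟨X, T^{t+1}_v (ι_* m′)⟩_{t+1} = ⟨red_* X, T⁰_v m′⟩_0`
  (`X ∈ H¹(K_v, T^{(t+1)})`, `m′ ∈ H¹(K_{σv}, T^{(0)})`); and **VANISH** `⟨ι_* m, T^{t+1}_v (ι_* m′)⟩_{t+1} = 0` (`red ∘ ι = 0`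
  on `T^{(0)}` as soon as `π^d T^{(0)} = 0`); each also after `inv_v` (`localTatePairingZMod`).
  Ingredients: the generic transpose adjunction (`localTatePairing_cohomologyMap_transpose`), transport naturality
  (`ConjugationDatum.transportH1_cohomologyMap_of_equivariant`), the bridge (`map_localMap_toTateDual_eq_cohomologyMap`) and §2.

HONEST FRAMING: the compatible pair `(λ₀, λ₁)` is a HYPOTHESIS here (its construction is separate); no pairing is constructed;
Prop. 1.4.1, C45.1′/C45.1″ and `thm161_dvrKolyvaginBound` are NOT proved; no summit statement is proved; the
Birch–Swinnerton-Dyer conjecture is not proved by any of this.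
-/

set_option autoImplicit false

noncomputable section

namespace Literature.NumberTheory.GaloisCohomology.Howard2004

open Function NumberField IsDedekindDomain Field CategoryTheory
open scoped NumberField ContRepresentation
open Literature.NumberTheory.GaloisRepresentations
open Literature.NumberTheory.GaloisRepresentations.DiscreteGaloisModule
open Literature.NumberTheory.GaloisCohomology (LocalInvariants)
open Literature.NumberTheory.EllipticCurves (DiscreteGaloisModule.localMap)

namespace DVRSetting

variable {p : ℕ} [Fact p.Prime] {K : Type} [Field K] [NumberField K]
  {R : Type} [CommRing R] [IsDomain R] [IsDiscreteValuationRing R] [Algebra ℤ_[p] R]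
  {N : ℕ → Type} [∀ k, AddCommGroup (N k)] [∀ k, TopologicalSpace (N k)]
  [∀ k, DiscreteTopology (N k)] [∀ k, Module R (N k)]
  {Rk : ℕ → Type} [∀ k, CommRing (Rk k)] [∀ k, IsLocalRing (Rk k)] [∀ k, TopologicalSpace (Rk k)]
  [∀ k, DiscreteTopology (Rk k)] [∀ k, Algebra ℤ_[p] (Rk k)] [∀ k, Algebra R (Rk k)]
  [∀ k, Module (Rk k) (N k)] [∀ k, IsScalarTower R (Rk k) (N k)]
  {Nbar : Type} [AddCommGroup Nbar] [TopologicalSpace Nbar] [DiscreteTopology Nbar]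
  [∀ k, Module (Rk k) Nbar]
  {Nq : ℕ → Finset (HeightOneSpectrum (𝓞 K)) → Type} [∀ k n, AddCommGroup (Nq k n)]
  [∀ k n, TopologicalSpace (Nq k n)] [∀ k n, DiscreteTopology (Nq k n)]
  [∀ k n, Module (Rk k) (Nq k n)] [∀ k n, Module R (Nq k n)]
  [∀ k n, IsScalarTower R (Rk k) (Nq k n)]

/-! ## §1 Bilinearity over `R` and `e_red` iterated -/

/-- `e_j(r • s, x) = [r] · e_j(s, x)` (`R` acts through `R → R_j`). [cite: Howard2004HeegnerKolyvagin, H.4 (arXiv:1202.6340 p. 7 L69–76)] -/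
theorem e_smul_left (S : DVRSetting p K R N Rk Nbar Nq) (j : ℕ) (r : R) (s x : N j) :
    (S.D j).e (r • s) x = algebraMap R (Rk j) r * (S.D j).e s x := by
  rw [← IsScalarTower.algebraMap_smul (Rk j) r s, map_smul, LinearMap.smul_apply, smul_eq_mul]

/-- `e_j(y, r • s) = [r] · e_j(y, s)`. [cite: Howard2004HeegnerKolyvagin, H.4 (arXiv:1202.6340 p. 7 L69–76)] -/
theorem e_smul_right (S : DVRSetting p K R N Rk Nbar Nq) (j : ℕ) (r : R) (y s : N j) :
    (S.D j).e y (r • s) = algebraMap R (Rk j) r * (S.D j).e y s := by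
  rw [← IsScalarTower.algebraMap_smul (Rk j) r s, map_smul, smul_eq_mul]

/-- **`e_red` iterated along `redLE`**: if `e_j(x, y)` is the class of `r ∈ R` in `R_j`, then `e_i(red x, red y)` is the class of
`r` in `R_i`, for `i ≤ j` («the pairings are compatible under reduction», `SatisfiesH.e_red` + `redR_comp`).
[cite: Howard2004HeegnerKolyvagin, H.4 and §1.6 (arXiv:1202.6340 p. 7 L69–82, p. 11 L33–38)] -/
theorem e_redLE_of_eq_algebraMap (S : DVRSetting p K R N Rk Nbar Nq) (hy : S.SatisfiesH) {i j : ℕ} (h : i ≤ j) :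
    ∀ {x y : N j} {r : R}, (S.D j).e x y = algebraMap R (Rk j) r →
      (S.D i).e (S.T.redLE h x) (S.T.redLE h y) = algebraMap R (Rk i) r := by
  induction j, h using Nat.le_induction with
  | base => intro x y r hr; rwa [S.T.redLE_self, S.T.redLE_self]
  | succ j h ih =>
    intro x y r hr
    rw [S.T.redLE_succ h, S.T.redLE_succ h]
    refine ih ?_
    rw [← hy.e_red, hr, hy.redR_comp]

/-! ## §2 The module identities: `ι^D ∘ Θ_{t+1} = Θ₀ ∘ red` and `Θ_{t+1} ∘ ι = red^D ∘ Θ₀` -/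

section Readings

variable (S : DVRSetting p K R N Rk Nbar Nq) (hy : S.SatisfiesH) {t : ℕ} (ι : N 0 →ₗ[R] N (t + 1))
  (hι : ∀ y : N (t + 1), ι (S.T.redLE (Nat.zero_le (t + 1)) y) = S.π ^ (S.e (t + 1) - S.e 0) • y)
  {k' : ℕ} (lam₀ : Rk 0 →+ ZMod (p ^ k')) (lam₁ : Rk (t + 1) →+ ZMod (p ^ k'))
  (hlam₀ : ∀ (z : ℤ_[p]) (r : Rk 0), lam₀ (algebraMap ℤ_[p] (Rk 0) z * r) = PadicInt.toZModPow k' z * lam₀ r)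
  (hlam₁ : ∀ (z : ℤ_[p]) (r : Rk (t + 1)), lam₁ (algebraMap ℤ_[p] (Rk (t + 1)) z * r) = PadicInt.toZModPow k' z * lam₁ r)
  (exp : ZMod (p ^ k') →+ MuCarrier K (p ^ k'))
  (hexp : ∀ (g : absoluteGaloisGroup K) (x : ZMod (p ^ k')), exp (cyclotomicCharacterModPow K p k' g * x) = mu K (p ^ k') g (exp x))
  (hcompat : ∀ r : R, lam₁ (algebraMap R (Rk (t + 1)) (S.π ^ (S.e (t + 1) - S.e 0) * r)) = lam₀ (algebraMap R (Rk 0) r))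

include hy hι hcompat

/-- **`ι^D ∘ Θ_{t+1} = Θ₀ ∘ red` on `Tw T^{(t+1)}`**: `Θ_{t+1}(x)(ι s) = Θ₀(red x)(s)` for `x ∈ T^{(t+1)}`, `s ∈ T^{(0)}` — with
`s = red s̃`: `e_{t+1}(ι red s̃, x) = π^d e_{t+1}(s̃, x)`, `λ₁(π^d r) = λ₀(r̄)` and `e₀(red s̃, red x) = e_{t+1}(s̃, x) mod 𝔪^{e_0}`.
[cite: Howard2004HeegnerKolyvagin, H.4 and §1.6 (arXiv:1202.6340 p. 7 L69–82, p. 11 L13–38)] -/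
theorem transpose_iota_toTateDual_eq [∀ k, Finite (N k)] (x : N (t + 1)) :
    pairingDualHom (p ^ k') ((tateDualEval K (N (t + 1)) (p ^ k')).comp ι.toAddMonoidHom)
        ((S.D (t + 1)).toTateDual lam₁ hlam₁ exp hexp x) =
      (S.D 0).toTateDual lam₀ hlam₀ exp hexp (S.T.redLE (Nat.zero_le (t + 1)) x) := by
  refine TateDual.ext fun s => ?_
  obtain ⟨s', rfl⟩ := S.T.redLE_surjective (Nat.zero_le (t + 1)) s
  obtain ⟨r, hr⟩ := hy.algebraMap_surjective (t + 1) ((S.D (t + 1)).e s' x)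
  rw [pairingDualHom_apply_apply, AddMonoidHom.comp_apply, LinearMap.toAddMonoidHom_coe, tateDualEval_apply,
    DualityDatum.toTateDual_apply_apply, DualityDatum.toTateDual_apply_apply, hι]
  have key : lam₁ ((S.D (t + 1)).e (S.π ^ (S.e (t + 1) - S.e 0) • s') x) =
      lam₀ ((S.D 0).e (S.T.redLE (Nat.zero_le (t + 1)) s') (S.T.redLE (Nat.zero_le (t + 1)) x)) := by
    rw [S.e_smul_left, ← hr, ← map_mul, hcompat r, S.e_redLE_of_eq_algebraMap hy (Nat.zero_le (t + 1)) hr.symm]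
  exact congrArg exp key

/-- **`Θ_{t+1} ∘ ι = red^D ∘ Θ₀` on `Tw T^{(0)}`**: `Θ_{t+1}(ι s)(y) = Θ₀(s)(red y)` for `s ∈ T^{(0)}`, `y ∈ T^{(t+1)}`
(`red^D = pairingDualHom (ev ∘ red)` the transpose of the reduction).
[cite: Howard2004HeegnerKolyvagin, H.4 and §1.6 (arXiv:1202.6340 p. 7 L69–82, p. 11 L13–38)] -/
theorem toTateDual_iota_eq_transpose_red [∀ k, Finite (N k)] (s : N 0) :
    (S.D (t + 1)).toTateDual lam₁ hlam₁ exp hexp (ι s) =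
      pairingDualHom (p ^ k') ((tateDualEval K (N 0) (p ^ k')).comp (S.T.redLE (Nat.zero_le (t + 1))).toAddMonoidHom)
        ((S.D 0).toTateDual lam₀ hlam₀ exp hexp s) := by
  refine TateDual.ext fun y => ?_
  obtain ⟨s', rfl⟩ := S.T.redLE_surjective (Nat.zero_le (t + 1)) s
  obtain ⟨r, hr⟩ := hy.algebraMap_surjective (t + 1) ((S.D (t + 1)).e y s')
  rw [pairingDualHom_apply_apply, AddMonoidHom.comp_apply, LinearMap.toAddMonoidHom_coe, tateDualEval_apply,
    DualityDatum.toTateDual_apply_apply, DualityDatum.toTateDual_apply_apply, hι]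
  have key : lam₁ ((S.D (t + 1)).e y (S.π ^ (S.e (t + 1) - S.e 0) • s')) =
      lam₀ ((S.D 0).e (S.T.redLE (Nat.zero_le (t + 1)) y) (S.T.redLE (Nat.zero_le (t + 1)) s')) := by
    rw [S.e_smul_right, ← hr, ← map_mul, hcompat r, S.e_redLE_of_eq_algebraMap hy (Nat.zero_le (t + 1)) hr.symm]
  exact congrArg exp key

/-! ## §3 The cross-level adjunctions ADJ-ι-T, ADJ-red-T and VANISH at a finite place -/

/-- **ADJ-ι-T.**  At a finite place `v`, for LOCAL `m ∈ H¹(K_v, T^{(0)})` and `z ∈ H¹(K_{σv}, T^{(t+1)})`: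
`⟨H¹_v(ι) m, H¹(Θ_{t+1}) transport_v z⟩_{T^{(t+1)}} = ⟨m, H¹(Θ₀) transport_v (H¹_{σv}(red) z)⟩_{T^{(0)}}` in `H²(K_v, μ_{p^{k′}})`
— transpose adjunction for `ι`, `ι^D ∘ Θ_{t+1} = Θ₀ ∘ red` on `H¹(K_v, ·)`, and transport naturality for `red`.
[cite: Howard2004HeegnerKolyvagin, proof of Thm. 1.4.2 (ii) (arXiv:1202.6340 p0008 L142 – p0009 L55) with H.4 / §1.6]
[cite: NeukirchSchmidtWingberg2008, I §4 (1.4.2)] -/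
theorem localTatePairing_cohomologyMap_iota_thetaTransport [∀ k, Finite (N k)]
    (hιg : ∀ (g : absoluteGaloisGroup K) (x : N 0), ι (S.T.ρ 0 g x) = S.T.ρ (t + 1) g (ι x))
    (v : HeightOneSpectrum (𝓞 K)) (m : galoisCohomology ((S.T.ρ 0).toLocal (Sum.inr v)) 1)
    (z : galoisCohomology ((S.T.ρ (t + 1)).toLocal (Sum.inr (S.cd.σ • v))) 1) :
    localTatePairing (S.T.ρ (t + 1)) (p ^ k') (Sum.inr v)
        (ContinuousRep.cohomologyMap ((S.T.ρ 0).toLocal (Sum.inr v)) ((S.T.ρ (t + 1)).toLocal (Sum.inr v))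
          ι.toAddMonoidHom continuous_of_discreteTopology (fun _ x => hιg _ x) 1 m)
        (galoisCohomology.map (DiscreteGaloisModule.localMap ((S.D (t + 1)).toTateDual lam₁ hlam₁ exp hexp) (Sum.inr v)) 1
          (S.cd.transportH1 (S.T.ρ (t + 1)) v z)) =
      localTatePairing (S.T.ρ 0) (p ^ k') (Sum.inr v) m
        (galoisCohomology.map (DiscreteGaloisModule.localMap ((S.D 0).toTateDual lam₀ hlam₀ exp hexp) (Sum.inr v)) 1
          (S.cd.transportH1 (S.T.ρ 0) v (S.redLELoc (Nat.zero_le (t + 1)) (Sum.inr (S.cd.σ • v)) z))) := by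
  rw [DualityDatum.map_localMap_toTateDual_eq_cohomologyMap, DualityDatum.map_localMap_toTateDual_eq_cohomologyMap,
    ← localTatePairing_cohomologyMap_transpose (S.T.ρ 0) (S.T.ρ (t + 1)) (p ^ k') ι.toAddMonoidHom hιg (Sum.inr v) m]
  congr 1
  -- transport naturality for `red`, then the square `ι^D ∘ Θ_{t+1} = Θ₀ ∘ Tw(red)` on `H¹(K_v, ·)`
  rw [show S.redLELoc (Nat.zero_le (t + 1)) (Sum.inr (S.cd.σ • v)) z =
      ContinuousRep.cohomologyMap ((S.T.ρ (t + 1)).toLocal (Sum.inr (S.cd.σ • v))) ((S.T.ρ 0).toLocal (Sum.inr (S.cd.σ • v)))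
        (S.T.redLE (Nat.zero_le (t + 1))).toAddMonoidHom continuous_of_discreteTopology
        (fun _ x => S.T.redLE_equivariant (Nat.zero_le (t + 1)) _ x) 1 z from rfl,
    ConjugationDatum.transportH1_cohomologyMap_of_equivariant S.cd (S.T.ρ (t + 1)) (S.T.ρ 0)
      (S.T.redLE (Nat.zero_le (t + 1))).toAddMonoidHom (S.T.redLE_equivariant (Nat.zero_le (t + 1))) v z]
  exact cohomologyMap_one_comm_sq ((S.cd.twist (S.T.ρ (t + 1))).toLocal (Sum.inr v))
    (((S.T.ρ (t + 1)).tateDual (p ^ k')).toLocal (Sum.inr v)) ((S.cd.twist (S.T.ρ 0)).toLocal (Sum.inr v))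
    (((S.T.ρ 0).tateDual (p ^ k')).toLocal (Sum.inr v))
    ((S.D (t + 1)).toTateDual lam₁ hlam₁ exp hexp).toContinuousLinearMap.toLinearMap.toAddMonoidHom
    (twist_semilinear_equivariant_toLocal S.cd (S.T.ρ (t + 1)) ((S.T.ρ (t + 1)).tateDual (p ^ k')) _
      ((S.D (t + 1)).toTateDual_semilinear lam₁ hlam₁ exp hexp) (Sum.inr v))
    (pairingDualHom (p ^ k') ((tateDualEval K (N (t + 1)) (p ^ k')).comp ι.toAddMonoidHom))
    (fun _ f => pairingDualHom_smul (pairing_comp_smul (S.T.ρ 0) (S.T.ρ (t + 1)) (p ^ k') ι.toAddMonoidHom hιg) _ f)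
    (S.T.redLE (Nat.zero_le (t + 1))).toAddMonoidHom
    (fun g x => S.T.redLE_equivariant (Nat.zero_le (t + 1)) (S.cd.conj (absGaloisRestrict K _ g)) x)
    ((S.D 0).toTateDual lam₀ hlam₀ exp hexp).toContinuousLinearMap.toLinearMap.toAddMonoidHom
    (twist_semilinear_equivariant_toLocal S.cd (S.T.ρ 0) ((S.T.ρ 0).tateDual (p ^ k')) _
      ((S.D 0).toTateDual_semilinear lam₀ hlam₀ exp hexp) (Sum.inr v))
    (fun x => S.transpose_iota_toTateDual_eq hy ι hι lam₀ lam₁ hlam₀ hlam₁ exp hexp hcompat x)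
    (S.cd.transportH1 (S.T.ρ (t + 1)) v z)

/-- **ADJ-red-T.**  At a finite place `v`, for LOCAL `X ∈ H¹(K_v, T^{(t+1)})` and `m′ ∈ H¹(K_{σv}, T^{(0)})`:
`⟨X, H¹(Θ_{t+1}) transport_v (H¹_{σv}(ι) m′)⟩_{T^{(t+1)}} = ⟨H¹_v(red) X, H¹(Θ₀) transport_v m′⟩_{T^{(0)}}` in `H²(K_v, μ_{p^{k′}})`
— transport naturality for `ι`, `Θ_{t+1} ∘ ι = red^D ∘ Θ₀` on `H¹(K_v, ·)`, and the transpose adjunction for `red`.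
[cite: Howard2004HeegnerKolyvagin, proof of Thm. 1.4.2 (ii) (arXiv:1202.6340 p0008 L142 – p0009 L55) with H.4 / §1.6]
[cite: NeukirchSchmidtWingberg2008, I §4 (1.4.2)] -/
theorem localTatePairing_thetaTransport_iota [∀ k, Finite (N k)]
    (hιg : ∀ (g : absoluteGaloisGroup K) (x : N 0), ι (S.T.ρ 0 g x) = S.T.ρ (t + 1) g (ι x))
    (v : HeightOneSpectrum (𝓞 K)) (X : galoisCohomology ((S.T.ρ (t + 1)).toLocal (Sum.inr v)) 1)
    (m' : galoisCohomology ((S.T.ρ 0).toLocal (Sum.inr (S.cd.σ • v))) 1) :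
    localTatePairing (S.T.ρ (t + 1)) (p ^ k') (Sum.inr v) X
        (galoisCohomology.map (DiscreteGaloisModule.localMap ((S.D (t + 1)).toTateDual lam₁ hlam₁ exp hexp) (Sum.inr v)) 1
          (S.cd.transportH1 (S.T.ρ (t + 1)) v
            (ContinuousRep.cohomologyMap ((S.T.ρ 0).toLocal (Sum.inr (S.cd.σ • v)))
              ((S.T.ρ (t + 1)).toLocal (Sum.inr (S.cd.σ • v))) ι.toAddMonoidHom continuous_of_discreteTopology
              (fun _ x => hιg _ x) 1 m'))) =
      localTatePairing (S.T.ρ 0) (p ^ k') (Sum.inr v) (S.redLELoc (Nat.zero_le (t + 1)) (Sum.inr v) X)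
        (galoisCohomology.map (DiscreteGaloisModule.localMap ((S.D 0).toTateDual lam₀ hlam₀ exp hexp) (Sum.inr v)) 1
          (S.cd.transportH1 (S.T.ρ 0) v m')) := by
  rw [DualityDatum.map_localMap_toTateDual_eq_cohomologyMap, DualityDatum.map_localMap_toTateDual_eq_cohomologyMap,
    ConjugationDatum.transportH1_cohomologyMap_of_equivariant S.cd (S.T.ρ 0) (S.T.ρ (t + 1)) ι.toAddMonoidHom hιg v m',
    cohomologyMap_one_comm_sq ((S.cd.twist (S.T.ρ 0)).toLocal (Sum.inr v)) ((S.cd.twist (S.T.ρ (t + 1))).toLocal (Sum.inr v))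
      (((S.T.ρ 0).tateDual (p ^ k')).toLocal (Sum.inr v)) (((S.T.ρ (t + 1)).tateDual (p ^ k')).toLocal (Sum.inr v))
      ι.toAddMonoidHom (fun g x => hιg (S.cd.conj (absGaloisRestrict K _ g)) x)
      ((S.D (t + 1)).toTateDual lam₁ hlam₁ exp hexp).toContinuousLinearMap.toLinearMap.toAddMonoidHom
      (twist_semilinear_equivariant_toLocal S.cd (S.T.ρ (t + 1)) ((S.T.ρ (t + 1)).tateDual (p ^ k')) _
        ((S.D (t + 1)).toTateDual_semilinear lam₁ hlam₁ exp hexp) (Sum.inr v))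
      ((S.D 0).toTateDual lam₀ hlam₀ exp hexp).toContinuousLinearMap.toLinearMap.toAddMonoidHom
      (twist_semilinear_equivariant_toLocal S.cd (S.T.ρ 0) ((S.T.ρ 0).tateDual (p ^ k')) _
        ((S.D 0).toTateDual_semilinear lam₀ hlam₀ exp hexp) (Sum.inr v))
      (pairingDualHom (p ^ k') ((tateDualEval K (N 0) (p ^ k')).comp (S.T.redLE (Nat.zero_le (t + 1))).toAddMonoidHom))
      (fun _ f => pairingDualHom_smul (pairing_comp_smul (S.T.ρ (t + 1)) (S.T.ρ 0) (p ^ k')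
        (S.T.redLE (Nat.zero_le (t + 1))).toAddMonoidHom (S.T.redLE_equivariant (Nat.zero_le (t + 1)))) _ f)
      (fun s => S.toTateDual_iota_eq_transpose_red hy ι hι lam₀ lam₁ hlam₀ hlam₁ exp hexp hcompat s)
      (S.cd.transportH1 (S.T.ρ 0) v m'),
    localTatePairing_cohomologyMap_transpose (S.T.ρ (t + 1)) (S.T.ρ 0) (p ^ k') (S.T.redLE (Nat.zero_le (t + 1))).toAddMonoidHom
      (S.T.redLE_equivariant (Nat.zero_le (t + 1))) (Sum.inr v) X]
  rfl

omit hcompat in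
/-- `red ∘ ι = 0` on `T^{(0)}` as soon as `e_0 ≤ d = e_{t+1} - e_0` (e.g. on a full tower): `ι(red s̃) = π^d s̃` and `π^d ∈ 𝔪^{e_0}`
kills `T^{(0)}`. [cite: Howard2004HeegnerKolyvagin, §1.6 (arXiv:1202.6340 p. 11 L13–38)] -/
theorem redLE_iota_eq_zero (hd : S.e 0 ≤ S.e (t + 1) - S.e 0) (s : N 0) : S.T.redLE (Nat.zero_le (t + 1)) (ι s) = 0 := by
  obtain ⟨s', rfl⟩ := S.T.redLE_surjective (Nat.zero_le (t + 1)) s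
  rw [hι, map_smul]
  refine hy.killed 0 _ (Ideal.pow_le_pow_right hd ?_) _
  have hπ : S.π ∈ IsLocalRing.maximalIdeal R := by rw [hy.unif]; exact Ideal.mem_span_singleton_self _
  exact Ideal.pow_mem_pow hπ _

include hlam₀ in
/-- **VANISH.**  `⟨H¹_v(ι) m, H¹(Θ_{t+1}) transport_v (H¹_{σv}(ι) m′)⟩_{T^{(t+1)}} = 0` for local `m ∈ H¹(K_v, T^{(0)})`,
`m′ ∈ H¹(K_{σv}, T^{(0)})`, when `red ∘ ι = 0` (ADJ-red-T through the compatible bottom reading `Θ₀`, and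
`H¹_v(red) ∘ H¹_v(ι) = H¹_v(red ∘ ι) = 0`).
[cite: Howard2004HeegnerKolyvagin, proof of Thm. 1.4.2 (ii) (arXiv:1202.6340 p0008 L142 – p0009 L55)] -/
theorem localTatePairing_iota_thetaTransport_iota_eq_zero [∀ k, Finite (N k)]
    (hιg : ∀ (g : absoluteGaloisGroup K) (x : N 0), ι (S.T.ρ 0 g x) = S.T.ρ (t + 1) g (ι x))
    (hιred : ∀ s : N 0, S.T.redLE (Nat.zero_le (t + 1)) (ι s) = 0)
    (v : HeightOneSpectrum (𝓞 K)) (m : galoisCohomology ((S.T.ρ 0).toLocal (Sum.inr v)) 1)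
    (m' : galoisCohomology ((S.T.ρ 0).toLocal (Sum.inr (S.cd.σ • v))) 1) :
    localTatePairing (S.T.ρ (t + 1)) (p ^ k') (Sum.inr v)
        (ContinuousRep.cohomologyMap ((S.T.ρ 0).toLocal (Sum.inr v)) ((S.T.ρ (t + 1)).toLocal (Sum.inr v))
          ι.toAddMonoidHom continuous_of_discreteTopology (fun _ x => hιg _ x) 1 m)
        (galoisCohomology.map (DiscreteGaloisModule.localMap ((S.D (t + 1)).toTateDual lam₁ hlam₁ exp hexp) (Sum.inr v)) 1
          (S.cd.transportH1 (S.T.ρ (t + 1)) v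
            (ContinuousRep.cohomologyMap ((S.T.ρ 0).toLocal (Sum.inr (S.cd.σ • v)))
              ((S.T.ρ (t + 1)).toLocal (Sum.inr (S.cd.σ • v))) ι.toAddMonoidHom continuous_of_discreteTopology
              (fun _ x => hιg _ x) 1 m'))) = 0 := by
  rw [S.localTatePairing_thetaTransport_iota hy ι hι lam₀ lam₁ hlam₀ hlam₁ exp hexp hcompat hιg v _ m']
  have hsq := cohomologyMap_one_comm_sq ((S.T.ρ 0).toLocal (Sum.inr v)) ((S.T.ρ (t + 1)).toLocal (Sum.inr v))
    ((S.T.ρ 0).toLocal (Sum.inr v)) ((S.T.ρ 0).toLocal (Sum.inr v))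
    ι.toAddMonoidHom (fun _ x => hιg _ x) (S.T.redLE (Nat.zero_le (t + 1))).toAddMonoidHom
    (fun _ x => S.T.redLE_equivariant (Nat.zero_le (t + 1)) _ x)
    (0 : N 0 →+ N 0) (fun _ _ => by simp) (0 : N 0 →+ N 0) (fun _ _ => by simp) (fun x => by simpa using hιred x) m
  change localTatePairing (S.T.ρ 0) (p ^ k') (Sum.inr v)
      (ContinuousRep.cohomologyMap ((S.T.ρ (t + 1)).toLocal (Sum.inr v)) ((S.T.ρ 0).toLocal (Sum.inr v))
        (S.T.redLE (Nat.zero_le (t + 1))).toAddMonoidHom continuous_of_discreteTopology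
        (fun _ x => S.T.redLE_equivariant (Nat.zero_le (t + 1)) _ x) 1
        (ContinuousRep.cohomologyMap ((S.T.ρ 0).toLocal (Sum.inr v)) ((S.T.ρ (t + 1)).toLocal (Sum.inr v))
          ι.toAddMonoidHom continuous_of_discreteTopology (fun _ x => hιg _ x) 1 m)) _ = 0
  rw [hsq]
  obtain ⟨z, rfl⟩ := oneCocycleClass_surjective _ m
  have h0 : ContinuousRep.cohomologyMap ((S.T.ρ 0).toLocal (Sum.inr v)) ((S.T.ρ 0).toLocal (Sum.inr v)) (0 : N 0 →+ N 0)
      continuous_of_discreteTopology (fun _ _ => by simp) 1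
      (ContinuousRep.cohomologyMap ((S.T.ρ 0).toLocal (Sum.inr v)) ((S.T.ρ 0).toLocal (Sum.inr v)) (0 : N 0 →+ N 0)
        continuous_of_discreteTopology (fun _ _ => by simp) 1 (oneCocycleClass _ z)) = 0 := by
    rw [cohomologyMap_one_oneCocycleClass, cohomologyMap_one_oneCocycleClass]
    refine (oneCocycleClass_eq_zero_iff _ _).2 ⟨0, fun g => ?_⟩
    change (0 : N 0 →+ N 0) ((0 : N 0 →+ N 0) (z.1 g)) = _
    simp
  rw [h0]
  exact (DFunLike.congr_fun (map_zero (localTatePairing (S.T.ρ 0) (p ^ k') (Sum.inr v))) _).trans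
    (AddMonoidHom.zero_apply _)

/-- **ADJ-ι-T after `inv_v`** (the `ℤ/p^{k′}`-valued local Tate pairing `localTatePairingZMod`).
[cite: Howard2004HeegnerKolyvagin, proof of Thm. 1.4.2 (ii) (arXiv:1202.6340 p0008 L142 – p0009 L55)] -/
theorem localTatePairingZMod_cohomologyMap_iota_thetaTransport [∀ k, Finite (N k)]
    (hιg : ∀ (g : absoluteGaloisGroup K) (x : N 0), ι (S.T.ρ 0 g x) = S.T.ρ (t + 1) g (ι x))
    (inv : LocalInvariants K (p ^ k')) (v : HeightOneSpectrum (𝓞 K)) (m : galoisCohomology ((S.T.ρ 0).toLocal (Sum.inr v)) 1)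
    (z : galoisCohomology ((S.T.ρ (t + 1)).toLocal (Sum.inr (S.cd.σ • v))) 1) :
    localTatePairingZMod (S.T.ρ (t + 1)) (p ^ k') (Sum.inr v) (inv (Sum.inr v))
        (ContinuousRep.cohomologyMap ((S.T.ρ 0).toLocal (Sum.inr v)) ((S.T.ρ (t + 1)).toLocal (Sum.inr v))
          ι.toAddMonoidHom continuous_of_discreteTopology (fun _ x => hιg _ x) 1 m)
        (galoisCohomology.map (DiscreteGaloisModule.localMap ((S.D (t + 1)).toTateDual lam₁ hlam₁ exp hexp) (Sum.inr v)) 1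
          (S.cd.transportH1 (S.T.ρ (t + 1)) v z)) =
      localTatePairingZMod (S.T.ρ 0) (p ^ k') (Sum.inr v) (inv (Sum.inr v)) m
        (galoisCohomology.map (DiscreteGaloisModule.localMap ((S.D 0).toTateDual lam₀ hlam₀ exp hexp) (Sum.inr v)) 1
          (S.cd.transportH1 (S.T.ρ 0) v (S.redLELoc (Nat.zero_le (t + 1)) (Sum.inr (S.cd.σ • v)) z))) := by
  rw [localTatePairingZMod_apply, localTatePairingZMod_apply,
    S.localTatePairing_cohomologyMap_iota_thetaTransport hy ι hι lam₀ lam₁ hlam₀ hlam₁ exp hexp hcompat hιg v m z]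

/-- **ADJ-red-T after `inv_v`**. [cite: Howard2004HeegnerKolyvagin, proof of Thm. 1.4.2 (ii) (arXiv:1202.6340 p0008 L142 – p0009 L55)] -/
theorem localTatePairingZMod_thetaTransport_iota [∀ k, Finite (N k)]
    (hιg : ∀ (g : absoluteGaloisGroup K) (x : N 0), ι (S.T.ρ 0 g x) = S.T.ρ (t + 1) g (ι x))
    (inv : LocalInvariants K (p ^ k')) (v : HeightOneSpectrum (𝓞 K))
    (X : galoisCohomology ((S.T.ρ (t + 1)).toLocal (Sum.inr v)) 1)
    (m' : galoisCohomology ((S.T.ρ 0).toLocal (Sum.inr (S.cd.σ • v))) 1) :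
    localTatePairingZMod (S.T.ρ (t + 1)) (p ^ k') (Sum.inr v) (inv (Sum.inr v)) X
        (galoisCohomology.map (DiscreteGaloisModule.localMap ((S.D (t + 1)).toTateDual lam₁ hlam₁ exp hexp) (Sum.inr v)) 1
          (S.cd.transportH1 (S.T.ρ (t + 1)) v
            (ContinuousRep.cohomologyMap ((S.T.ρ 0).toLocal (Sum.inr (S.cd.σ • v)))
              ((S.T.ρ (t + 1)).toLocal (Sum.inr (S.cd.σ • v))) ι.toAddMonoidHom continuous_of_discreteTopology
              (fun _ x => hιg _ x) 1 m'))) =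
      localTatePairingZMod (S.T.ρ 0) (p ^ k') (Sum.inr v) (inv (Sum.inr v)) (S.redLELoc (Nat.zero_le (t + 1)) (Sum.inr v) X)
        (galoisCohomology.map (DiscreteGaloisModule.localMap ((S.D 0).toTateDual lam₀ hlam₀ exp hexp) (Sum.inr v)) 1
          (S.cd.transportH1 (S.T.ρ 0) v m')) := by
  rw [localTatePairingZMod_apply, localTatePairingZMod_apply,
    S.localTatePairing_thetaTransport_iota hy ι hι lam₀ lam₁ hlam₀ hlam₁ exp hexp hcompat hιg v X m']

include hlam₀ in
/-- **VANISH after `inv_v`**. [cite: Howard2004HeegnerKolyvagin, proof of Thm. 1.4.2 (ii) (arXiv:1202.6340 p0008 L142 – p0009 L55)] -/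
theorem localTatePairingZMod_iota_thetaTransport_iota_eq_zero [∀ k, Finite (N k)]
    (hιg : ∀ (g : absoluteGaloisGroup K) (x : N 0), ι (S.T.ρ 0 g x) = S.T.ρ (t + 1) g (ι x))
    (hιred : ∀ s : N 0, S.T.redLE (Nat.zero_le (t + 1)) (ι s) = 0)
    (inv : LocalInvariants K (p ^ k')) (v : HeightOneSpectrum (𝓞 K)) (m : galoisCohomology ((S.T.ρ 0).toLocal (Sum.inr v)) 1)
    (m' : galoisCohomology ((S.T.ρ 0).toLocal (Sum.inr (S.cd.σ • v))) 1) :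
    localTatePairingZMod (S.T.ρ (t + 1)) (p ^ k') (Sum.inr v) (inv (Sum.inr v))
        (ContinuousRep.cohomologyMap ((S.T.ρ 0).toLocal (Sum.inr v)) ((S.T.ρ (t + 1)).toLocal (Sum.inr v))
          ι.toAddMonoidHom continuous_of_discreteTopology (fun _ x => hιg _ x) 1 m)
        (galoisCohomology.map (DiscreteGaloisModule.localMap ((S.D (t + 1)).toTateDual lam₁ hlam₁ exp hexp) (Sum.inr v)) 1
          (S.cd.transportH1 (S.T.ρ (t + 1)) v
            (ContinuousRep.cohomologyMap ((S.T.ρ 0).toLocal (Sum.inr (S.cd.σ • v)))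
              ((S.T.ρ (t + 1)).toLocal (Sum.inr (S.cd.σ • v))) ι.toAddMonoidHom continuous_of_discreteTopology
              (fun _ x => hιg _ x) 1 m'))) = 0 := by
  rw [localTatePairingZMod_apply,
    S.localTatePairing_iota_thetaTransport_iota_eq_zero hy ι hι lam₀ lam₁ hlam₀ hlam₁ exp hexp hcompat hιg hιred v m m', map_zero]

end Readings

end DVRSetting

end Literature.NumberTheory.GaloisCohomology.Howard2004

end
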